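import Literature.MathematicalPhysics.QuantumFieldTheory.Balaban1983to89.B9Thm312WholeBlocksPairM
import Literature.MathematicalPhysics.QuantumFieldTheory.Balaban1983to89.B9Thm312WholeDirB

/-!
# `Balaban1983to89.B9Thm312WholeBlocksPairMB` — [B9] Theorem 3.12 (p. 423): the Hölder block (3.43)–(3.45) of a kernel family co-read by one
# Sect.-D propagator on the pair family, WITH β-INDEXED PROBE-STEP CONSTANTS AND ε-INDEXED INPUT-STEP CONSTANTS (the twin of
# `B9Thm312WholeBlocksPairM.holder_of_step_pairM` for the reshaped schema `B9Thm312WholeDirB.StepDirB`; located remarks U2 ∕ U3, referee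
# WATCH-A6-N06-STEPDIR-EPSUNIFORM)

T. Bałaban, *Propagators for lattice gauge theories in a background field*, Commun. Math. Phys. **99** (1985) 389–434
[`Balaban1985BackgroundPropagators`, "B9"]; [4] = T. Bałaban, *Propagators and renormalization transformations for lattice gauge
theories. II*, Commun. Math. Phys. **96** (1984) 223–250 [`Balaban1984PropagatorsII`].

statement-level skeleton of published theorems with citation tags; proofs where landed; nothing here is a claim about the Yang–Mills
mass gap

THE POINT.  `holder_of_step_pairM` reads the five step families `hsDd hpY hpX hpXd htDd` with ONE constant θ_H; print's Hölder ∕ input constants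
B₀(β), B′₀(ε) depend on β resp. ε (Theorem 3.1, pp. 397–398).  THIS FILE re-proves the same block with θ_H : ℝ → ℝ on the probe members (at β)
and θ_I : ℝ → ℝ on the right-form members (at ε) — the fields of `StepDirB` at T — and output constant FAMILIES
β ↦ m·CL·e^{rρ_f}(B_h(β) + θ_H(β)B₀(1 − θc)⁻¹c), ε ↦ e^{rρ_f}(B_i(ε) + C₁′Λ₁θ_I(ε)c),
(ε,β) ↦ CL·e^{rρ_f}(B_i2(ε,β) + (B_h(β) + θ_M B₀(1 − θc)⁻¹c)Λ₁θ_M c) with θ_M = max(θ_H(β), θ_I(β+ε)) (the (3.45) member reads the probe step at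
β and the input step at β + ε).  The proof is `holder_of_step_pairM`'s, member by member.  COUNT-NEUTRAL; N06 is NOT discharged; one finite
lattice at a time; nothing continuum, nothing about the mass gap.  Cell `pub-ymgap` (HUMAN RULING D-0062), Track A node N06 [B9], rows 20–21
(bundle F7), seat `pub-ymgap-dag-n06-l` (g12), 2026-08-27.
-/

namespace Literature.MathematicalPhysics.QuantumFieldTheory.Balaban1983to89.B9Thm312WholeBlocksPairMB

open Literature.MathematicalPhysics.QuantumFieldTheory.Balaban1983to89
open Finset B6RandomWalk B6RandomWalkHom B9Thm34Ext B9Thm37Glue B9Thm37GlueCor36 B11SectG B9SectDSup B9SectDL2Decay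
open B9Thm37AllNorms B9Thm37AllNormsInstances B9FromB6 B9FromB6ModelSignsOn B9SectBStepWhole B9Thm312Whole B9Thm312WholeLeaf
open B9Thm312WholeLeft B9RWSums343Holder B9RWSums346Schur B9RWSumsReadsRel B9RWSumsReadsNbr B9Ineq347 B9Thm312WholeClasses
open B9Thm312WholeHolder B9Thm312WholeL2 B9Thm312WholeBlocksRel B9RWSums346SecondDiff B9Thm312WholeBlocksNbr B9Thm312WholeBlocksNbrRec
open B9RWSums344InputFam B9Thm312WholeDir B9Thm312WholeBlocksPairM B9Thm312WholeDirB

noncomputable section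

section OneMember

variable {g : B9.Geometry} {B : B9.Backgrounds} {X Y Z W PX PY P : Type}
variable [Fintype X] [Fintype Y] [Fintype PX] [Fintype PY] [Fintype P] [Fintype g.Site] [DecidableEq g.Site]
variable {R₀ : ℝ} {H₀ : Prop}

omit [Fintype X] [Fintype Y] [Fintype PX] [Fintype PY] [Fintype P] [DecidableEq g.Site] in
/-- Raising the constant of an exponential majorant. [folklore] -/
private theorem maj_mono_const' {F₁ F₂ : Type} [AddCommGroup F₁] [Module ℝ F₁] [AddCommGroup F₂] [Module ℝ F₂]
    {b₁ : BlockNorm (toB6 g R₀ H₀) F₁} {b₂ : BlockNorm (toB6 g R₀ H₀) F₂} {T : F₁ →ₗ[ℝ] F₂} {C C' δK : ℝ} (hCC' : C ≤ C')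
    (h : HasMaj b₁ b₂ T (fun a b => C * Real.exp (-(δK * g.dist a b)))) :
    HasMaj b₁ b₂ T (fun a b => C' * Real.exp (-(δK * g.dist a b))) :=
  h.mono fun _ _ => mul_le_mul_of_nonneg_right hCC' (Real.exp_nonneg _)

/-- ★ **THEOREM 3.12 — THE HÖLDER BLOCK (3.43)–(3.45) ON THE PAIR FAMILY WITH β∕ε-INDEXED STEP CONSTANTS** (the twin of
`B9Thm312WholeBlocksPairM.holder_of_step_pairM`; same data, the five step families now the fields of `StepDirB` at T: probe members at θ_H(β),
right-form members at θ_I(ε)).  Conclusion: `B9.Ineq343_345 K (β ↦ m·CL·e^{rρ_f}(B_h β + θ_H β·B₀(1 − θc)⁻¹c)) (ε ↦ e^{rρ_f}(B_i ε + C₁′Λ₁θ_I ε·c))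
((ε,β) ↦ CL·e^{rρ_f}(B_i2 ε β + (B_h β + θ_M·B₀(1 − θc)⁻¹c)Λ₁θ_M c)) ρ_f U`, θ_M = max(θ_H β, θ_I (β+ε)), C₁′ = B₀ + θ_DB₀(1 − θc)⁻¹c.  Nothing of print
asserted. [cite: Balaban1985BackgroundPropagators, Thm 3.12 p.423 + Thm 3.3 p.399 + (3.43)–(3.45) p.398 + (3.39)–(3.40) p.397 + (3.130)–(3.131) pp.421–422 + (3.138) p.423; Balaban1984PropagatorsII, (2.51)–(2.52) p.232 + Lemma 2.1 (2.60)–(2.61) p.234] -/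
theorem holder_of_step_pairMB (hG : GeoOK g) {K : B9.KernelFamily g B} {U : B.Cfg} (𝔬 : Ops g B X Y Z W)
    (𝔭 : HolderProbes g B X Y PX PY) (Dd Dds : B.Cfg → P → Module.End ℝ (X → ℝ)) (bHX : ℝ → BlockNorm (toB6 g R₀ H₀) (X → ℝ))
    (Rel : g.Site → g.Site → Prop) [DecidableRel Rel] (ev : g.Loc → X → ℝ) (evY : g.Loc → Y → ℝ)
    {A T : Module.End ℝ (X → ℝ)} {m : ℕ}
    {r CL θ θD B₀ δ₀ δK ρ ρf σ α c Λ₁ : ℝ} {θH θI Bh Bi : ℝ → ℝ} {Bi2 : ℝ → ℝ → ℝ}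
    (hrow : RowSum (toB6 g R₀ H₀) σ c)
    (hθ : 0 ≤ θ) (hθD : 0 ≤ θD) (hθH : ∀ β, 0 ≤ β → β < 1 → 0 ≤ θH β) (hθI : ∀ ε, 0 < ε → 0 ≤ θI ε) (hB₀ : 0 ≤ B₀)
    (hσ : 0 ≤ σ) (hα : 0 ≤ α)
    (hρ : 0 ≤ ρ) (hρS : ρ ≤ δ₀) (hρδ : ρ + σ ≤ δK) (hq : θ * c < 1)
    (hρf : 0 ≤ ρf) (hρf1 : ρf + σ ≤ (1 - α) * ρ) (hΛ₁ : 0 ≤ Λ₁)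
    (hBh : ∀ β, 0 ≤ β → β < 1 → 0 ≤ Bh β) (hBi : ∀ ε, 0 < ε → ε ≤ 1 → 0 ≤ Bi ε)
    (hBi2 : ∀ ε β, 0 < ε → ε ≤ 1 → 0 ≤ β → β < 1 → 0 ≤ Bi2 ε β)
    (hST1 : ScaleTransfer g ρ α Λ₁ (fun y => g.len y ^ (1 : ℝ)))
    (hI0 : 𝔬.G0 U * 𝔬.S0 U = 1) (hIA : (𝔬.S0 U - T) * A = 1)
    (he0 : HasMajorant (g := toB6 g R₀ H₀) 𝔬.blk (𝔬.G0 U) (fun a b => B₀ * g.len a ^ 2 * Real.exp (-(δ₀ * g.dist a b))))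
    (he2 : HasMajorantHom (g := toB6 g R₀ H₀) 𝔬.blkY 𝔬.blk (𝔬.G0 U ∘ₗ 𝔬.Dstar U)
      (fun (a b : g.Site) => B₀ * g.len a * Real.exp (-(δ₀ * g.dist a b))))
    (hH0 : Thm33G0Dir 𝔬 𝔭 Dd Dds R₀ H₀ bHX B₀ Bh Bi Bi2 δ₀ U)
    (hK1 : HasMaj (cNorm R₀ H₀ 𝔬.blk hG.lenle 1) (cNorm R₀ H₀ 𝔬.blk hG.lenle 1) (𝔬.G0 U ∘ₗ T)
      (fun a b => θ * Real.exp (-(δK * g.dist a b))))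
    (hK2 : HasMaj (cNorm R₀ H₀ 𝔬.blk hG.lenle 2) (cNorm R₀ H₀ 𝔬.blk hG.lenle 2) (𝔬.G0 U ∘ₗ T)
      (fun a b => θ * Real.exp (-(δK * g.dist a b))))
    (hsDd : ∀ ν : P, HasMaj (cNorm R₀ H₀ 𝔬.blk hG.lenle 2) (cNorm R₀ H₀ 𝔬.blk hG.lenle 1) (Dd U ν ∘ₗ 𝔬.G0 U ∘ₗ T)
      (fun a b => θD * Real.exp (-(δK * g.dist a b))))
    (hpY : ∀ β : ℝ, 0 ≤ β → β < 1 → HasMaj (cNormR R₀ H₀ 𝔬.blk hG.lenle (-2)) (cNormR R₀ H₀ 𝔭.blkPY hG.lenle (β - 1))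
      ((𝔭.ΦY U β ∘ₗ 𝔬.D U ∘ₗ 𝔬.G0 U) ∘ₗ T) (fun a b => θH β * Real.exp (-(δK * g.dist a b))))
    (hpX : ∀ β : ℝ, 0 ≤ β → β < 1 → HasMaj (cNormR R₀ H₀ 𝔬.blk hG.lenle (-1)) (cNormR R₀ H₀ 𝔭.blkPX hG.lenle (β - 1))
      ((𝔭.ΦX U β ∘ₗ 𝔬.G0 U) ∘ₗ T) (fun a b => θH β * Real.exp (-(δK * g.dist a b))))
    (hpXd : ∀ (ν : P) (β : ℝ), 0 ≤ β → β < 1 → HasMaj (cNormR R₀ H₀ 𝔬.blk hG.lenle (-2)) (cNormR R₀ H₀ 𝔭.blkPX hG.lenle (β - 1))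
      ((𝔭.ΦX U β ∘ₗ Dd U ν ∘ₗ 𝔬.G0 U) ∘ₗ T) (fun a b => θH β * Real.exp (-(δK * g.dist a b))))
    (htDd : ∀ (μ : P) (ε : ℝ), 0 < ε → HasMaj (bHX ε) (cNormR R₀ H₀ 𝔬.blk hG.lenle 1) (T ∘ₗ (𝔬.G0 U ∘ₗ Dds U μ))
      (fun a b => θI ε * Real.exp (-(δK * g.dist a b))))
    (hRd₂ : ∀ a b b', Rel b b' → g.dist a b = g.dist a b')
    (hmult : ∀ y' : g.Site, (Finset.univ.filter (fun y'' => Rel y'' y')).card ≤ m)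
    (hCL1 : 1 ≤ CL) (hCL : ∀ a a' : g.Site, g.dist a a' ≤ r → g.len a ≤ CL * g.len a')
    (hH1 : H1ReadsNbr K U 𝔭 Rel r 𝔬.blk 𝔬.blkY ev evY (𝔬.D U ∘ₗ A) (A ∘ₗ 𝔬.Dstar U))
    (hIR : InputReadsFam K U bHX r (𝔬.blk ∘ Prod.fst) (𝔭.blkPX ∘ Prod.fst) (fun β => sliceProbe (𝔭.ΦX U β)) ev
      (familyOp (fun q : P × P => Dd U q.1 ∘ₗ (A ∘ₗ Dds U q.2)))) :
    B9.Ineq343_345 K (fun β => m * CL * Real.exp (r * ρf) * (Bh β + θH β * (B₀ * (1 - θ * c)⁻¹) * c))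
      (fun ε => Real.exp (r * ρf) * (Bi ε + (B₀ + θD * (B₀ * (1 - θ * c)⁻¹) * c) * Λ₁ * θI ε * c))
      (fun ε β => CL * Real.exp (r * ρf) *
        (Bi2 ε β + (Bh β + max (θH β) (θI (β + ε)) * (B₀ * (1 - θ * c)⁻¹) * c) * Λ₁ * max (θH β) (θI (β + ε)) * c)) ρf U := by
  -- adapted from `B9Thm312WholeBlocksPairM.holder_of_step_pairM` (θ_H ↦ θ_H(β), θ_I(ε); the (3.45) member at the common constant θ_M)
  have hc : 0 ≤ c ∨ IsEmpty g.Site := by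
    by_cases hne : Nonempty g.Site
    · exact Or.inl (hrow.nonneg hne.some)
    · exact Or.inr (not_nonempty_iff.mp hne)
  rcases hc with hc | hemp
  swap
  · exact ⟨fun β lam ζ y => (hemp.false y).elim, fun ε lam y => (hemp.false y).elim, fun ε β lam ζ y => (hemp.false y).elim⟩
  have hq1 : 0 ≤ (1 - θ * c)⁻¹ := inv_nonneg.mpr (by linarith)
  have hB₀'0 : 0 ≤ B₀ * (1 - θ * c)⁻¹ := mul_nonneg hB₀ hq1
  have hC₁0 : 0 ≤ B₀ + θD * (B₀ * (1 - θ * c)⁻¹) * c := add_nonneg hB₀ (mul_nonneg (mul_nonneg hθD hB₀'0) hc)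
  have hρfρ : ρf ≤ ρ := by nlinarith
  have hρfK : ρf ≤ δK := by linarith
  have hρf0 : ρf ≤ δ₀ := hρfρ.trans hρS
  have hexp : ∀ {r₁ r' : ℝ}, r' ≤ r₁ → ∀ y y' : g.Site, Real.exp (-(r₁ * g.dist y y')) ≤ Real.exp (-(r' * g.dist y y')) :=
    fun h y y' => Real.exp_le_exp.mpr (neg_le_neg (mul_le_mul_of_nonneg_right h (hG.dnn y y')))
  have hfix : A = 𝔬.G0 U + 𝔬.G0 U ∘ₗ T ∘ₗ A := fix_of_inverses hI0 hIA
  have hfixR : A = 𝔬.G0 U + A ∘ₗ T ∘ₗ 𝔬.G0 U := fix_right_of_inverses hI0 hIA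
  have hBhA : ∀ β, 0 ≤ β → β < 1 → 0 ≤ Bh β + θH β * (B₀ * (1 - θ * c)⁻¹) * c := fun β h0 h1 =>
    add_nonneg (hBh β h0 h1) (mul_nonneg (mul_nonneg (hθH β h0 h1) hB₀'0) hc)
  -- θ_M(ε, β) = max(θ_H β, θ_I (β+ε)) and its sign
  have hθM : ∀ ε β, 0 < ε → 0 ≤ β → β < 1 → 0 ≤ max (θH β) (θI (β + ε)) := fun ε β hε h0 h1 =>
    le_max_of_le_left (hθH β h0 h1)
  have hBhM : ∀ ε β, 0 < ε → 0 ≤ β → β < 1 → 0 ≤ Bh β + max (θH β) (θI (β + ε)) * (B₀ * (1 - θ * c)⁻¹) * c :=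
    fun ε β hε h0 h1 => add_nonneg (hBh β h0 h1) (mul_nonneg (mul_nonneg (hθM ε β hε h0 h1) hB₀'0) hc)
  -- (3.43) at the rate ρ, weakened to ρf
  have h43L : ∀ β, 0 ≤ β → β < 1 → HasMajorantHom (g := toB6 g R₀ H₀) 𝔬.blk 𝔭.blkPY (𝔭.ΦY U β ∘ₗ (𝔬.D U ∘ₗ A))
      (fun (a b : g.Site) => (Bh β + θH β * (B₀ * (1 - θ * c)⁻¹) * c) * g.len a ^ (1 - β) * Real.exp (-(ρf * g.dist a b))) := by
    intro β h0 h1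
    have h := probe43L_of_step hG 𝔭 hrow hθ (hθH β h0 h1) hB₀ (hBh β h0 h1) hρ hρS hρδ hK2 he0 (hH0.h43L β h0 h1) (hpY β h0 h1)
      hfix hq
    exact hasMajorantHom_mono (g := toB6 g R₀ H₀) 𝔬.blk 𝔭.blkPY h fun a b =>
      mul_le_mul_of_nonneg_left (hexp hρfρ a b) (mul_nonneg (hBhA β h0 h1) (Real.rpow_nonneg (hG.lenle a) _))
  have h43R : ∀ β, 0 ≤ β → β < 1 → HasMajorantHom (g := toB6 g R₀ H₀) 𝔬.blkY 𝔭.blkPX (𝔭.ΦX U β ∘ₗ (A ∘ₗ 𝔬.Dstar U))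
      (fun (a b : g.Site) => (Bh β + θH β * (B₀ * (1 - θ * c)⁻¹) * c) * g.len a ^ (1 - β) * Real.exp (-(ρf * g.dist a b))) := by
    intro β h0 h1
    have h := probe43R_of_step hG 𝔭 hrow hθ (hθH β h0 h1) hB₀ (hBh β h0 h1) hρ hρS hρδ hK1 he2 (hH0.h43R β h0 h1) (hpX β h0 h1)
      hfix hq
    exact hasMajorantHom_mono (g := toB6 g R₀ H₀) 𝔬.blkY 𝔭.blkPX h fun a b =>
      mul_le_mul_of_nonneg_left (hexp hρfρ a b) (mul_nonneg (hBhA β h0 h1) (Real.rpow_nonneg (hG.lenle a) _))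
  -- the per-direction left entries ∇_{U,ν}A at the rate ρ
  have hm1d : ∀ ν : P, HasMajorantHom (g := toB6 g R₀ H₀) 𝔬.blk 𝔬.blk (Dd U ν ∘ₗ A)
      (fun a b => (B₀ + θD * (B₀ * (1 - θ * c)⁻¹) * c) * g.len a * Real.exp (-(ρ * g.dist a b))) := fun ν =>
    entry1_of_stepD hG hrow hθ hθD hB₀ hρ hρS hρδ hK2 (hsDd ν) he0 (hH0.e1d ν) hfix hq
  -- (3.44) on the pair family at the rate ρf, input step at θ_I(ε)
  have h44 : ∀ ε, 0 < ε → ε ≤ 1 → HasMaj (bHX ε) (BlockNorm.ofBlocks (toB6 g R₀ H₀) (𝔬.blk ∘ Prod.fst))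
      (familyOp (fun q : P × P => Dd U q.1 ∘ₗ (A ∘ₗ Dds U q.2)))
      (fun (a b : g.Site) => (Bi ε + (B₀ + θD * (B₀ * (1 - θ * c)⁻¹) * c) * Λ₁ * θI ε * c) *
        Real.exp (-(ρf * g.dist a b))) := fun ε h0 h1 =>
    input44_family_of_step hG hrow (hθI ε h0) (hBi ε h0 h1) hC₁0 hΛ₁ hρf hρf1 hρfK hρf0 hST1 hm1d (fun q => hH0.h44m q ε h0 h1)
      (fun μ => htDd μ ε h0) hfixR
  -- (3.45) on the pair family at the rate ρf, probe step at β and input step at β + ε raised to the common constant θ_M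
  have h45 : ∀ ε β, 0 < ε → ε ≤ 1 → 0 ≤ β → β < 1 →
      HasMaj (bHX (β + ε)) (BlockNorm.ofBlocks (toB6 g R₀ H₀) (𝔭.blkPX ∘ Prod.fst))
        (sliceProbe (𝔭.ΦX U β) ∘ₗ familyOp (fun q : P × P => Dd U q.1 ∘ₗ (A ∘ₗ Dds U q.2)))
        (fun (a b : g.Site) => (Bi2 ε β + (Bh β + max (θH β) (θI (β + ε)) * (B₀ * (1 - θ * c)⁻¹) * c) * Λ₁ *
            max (θH β) (θI (β + ε)) * c) * g.len a ^ (-β) * Real.exp (-(ρf * g.dist a b))) := fun ε β hε0 hε1 h0 h1 =>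
    input45_family_of_step hG hrow hθ (hθM ε β hε0 h0 h1) hB₀ (hBh β h0 h1) (hBi2 ε β hε0 hε1 h0 h1) hΛ₁ hρ hρS hρδ hρf hρf1 hρfK
      hρf0 hST1 hK2 he0 (fun ν => hH0.h43d ν β h0 h1) (fun ν => maj_mono_const' (le_max_left _ _) (hpXd ν β h0 h1))
      (fun q => hH0.h45m q ε β hε0 hε1 h0 h1)
      (fun μ => maj_mono_const' (le_max_right _ _) (htDd μ (β + ε) (by linarith))) hfix hfixR hq
  exact ineq343_345_of_majorants_pairM (R := R₀) (H := H₀) hG 𝔭 bHX hRd₂ hmult hCL1 hCL hBhA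
    (fun ε h0 h1 => add_nonneg (hBi ε h0 h1) (mul_nonneg (mul_nonneg (mul_nonneg hC₁0 hΛ₁) (hθI ε h0)) hc))
    (fun ε β hε0 hε1 h0 h1 => add_nonneg (hBi2 ε β hε0 hε1 h0 h1)
      (mul_nonneg (mul_nonneg (mul_nonneg (hBhM ε β hε0 h0 h1) hΛ₁) (hθM ε β hε0 h0 h1)) hc))
    hρf h43L h43R h44 h45 hH1 hIR

end OneMember

end

end Literature.MathematicalPhysics.QuantumFieldTheory.Balaban1983to89.B9Thm312WholeBlocksPairMB
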